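import Mathlib
import HarnessLib

/-!
# Fermat cycles — the Klein cubic threefold: no critical point of `φ_ℓ = z₀z₁z₂z₃z₄/ℓ⁵` on `K₃` has Hessian corank `≥ 3`
# (a constant-coefficient Nullstellensatz certificate for the `3×3` minors of the linear matrix `N(a)`, kernel-checked)

HONEST FRAMING: explicit algebraic cycles for specific Hodge classes on Fermat/Delsarte varieties; residual open
instances listed; no claim on general Hodge.  This file formalises NO geometry.  It kernel-checks ONE polynomial
identity in `ℤ[a₁,a₂,a₃,a₄]` found by the cell's unit `pub-hfermat-search-2` (gen-12, `ALBANESE.md` §5.11,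
`code/resA/nullcert3_sym.py`; re-verified by an independent sympy expansion on the compute pool) and draws its
linear-algebra consequence.

Context (cell files `run/shared/lean/pub/pub-hfermat/pub-hfermat-search-2/ALBANESE.md` §5.10–5.11, informal, NOT
asserted here).  For the Klein cubic threefold `K₃ = {Σ_{i ∈ ℤ/5} zᵢ² zᵢ₊₁ = 0} ⊂ ℙ⁴` and a linear form `ℓ`, the
critical points of `φ_ℓ = z₀⋯z₄/ℓ⁵` on `K₃` off the base locus are governed, in logarithmic coordinates, by the
symmetric `5×5` matrix `S = −I + wwᵀ/5 − 2M_a` (`aᵢ = zᵢ²zᵢ₊₁` rescaled by the Lagrange multiplier,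
`Σ aᵢ = 0`); the Hessian corank of `φ_ℓ|K₃` at the point equals `5 − rank S = 5 − rank N(a)` with the
AFFINE-LINEAR matrix `N(a) = J − 5I − 10M_a` below (`J` the all-ones matrix, `(M_a)ᵢᵢ = (M_a)ᵢ,ᵢ₊₁ = (M_a)ᵢ₊₁,ᵢ = aᵢ`).
The identity `cert` says that an INTEGER combination of twenty `3×3` minors of `N(a)` is the constant `2250`,
identically in `a`; hence (`exists_minor_ne_zero`) over any commutative ring in which `2250 ≠ 0` some `3×3` minor
of `N(a)` is non-zero, i.e. `rank N(a) ≥ 3`: corank-`≥ 3` (never simple) critical points do not occur, for any `ℓ`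
and any point, on or off the coordinate torus.  This is step (A3) of residue (A) of the unit's "Theorem R*".

References: cell files as above; V. I. Arnold, S. M. Gusein-Zade, A. N. Varchenko, Singularities of Differentiable
Maps I (Birkhäuser 1985), §15 (simple singularities have corank ≤ 2) — cited for context only.
-/

namespace Summit.HodgeConjecture.HodgeConjecture.FermatCycles.KleinCriticalCorank

set_option maxRecDepth 8192

open Matrix

variable {R : Type*} [CommRing R]

/-- `N(a) = J − 5·I − 10·M_a` for `a = (a₀,…,a₄)` with `a₀ = −(a₁+a₂+a₃+a₄)`:
`Nᵢᵢ = −4 − 10aᵢ`, `Nᵢ,ᵢ₊₁ = Nᵢ₊₁,ᵢ = 1 − 10aᵢ` (indices mod 5), all other entries `1`. [folklore] -/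
def N (a₁ a₂ a₃ a₄ : R) : Matrix (Fin 5) (Fin 5) R :=
  !![-4 + 10 * (a₁ + a₂ + a₃ + a₄), 1 + 10 * (a₁ + a₂ + a₃ + a₄), 1, 1, 1 - 10 * a₄;
     1 + 10 * (a₁ + a₂ + a₃ + a₄), -4 - 10 * a₁, 1 - 10 * a₁, 1, 1;
     1, 1 - 10 * a₁, -4 - 10 * a₂, 1 - 10 * a₂, 1;
     1, 1, 1 - 10 * a₂, -4 - 10 * a₃, 1 - 10 * a₃;
     1 - 10 * a₄, 1, 1, 1 - 10 * a₃, -4 - 10 * a₄]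

/-- the `3×3` minor of `A` with rows `i,j,k` and columns `p,q,r`. [folklore] -/
def m3 (A : Matrix (Fin 5) (Fin 5) R) (i j k p q r : Fin 5) : R :=
  (A.submatrix ![i, j, k] ![p, q, r]).det

/-- orbit sum `O1` = Σ_{g ∈ ℤ/5} of the `3×3` minor with rows `{0,1,2}+g`, columns `{0,2,4}+g` (index sets re-sorted). [folklore] -/
def O1 (A : Matrix (Fin 5) (Fin 5) R) : R :=
  m3 A 0 1 2 0 2 4 + m3 A 1 2 3 0 1 3 + m3 A 2 3 4 1 2 4 + m3 A 0 3 4 0 2 3 + m3 A 0 1 4 1 3 4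

/-- orbit sum `O2`: rows `{0,1,2}+g`, columns `{0,3,4}+g`. [folklore] -/
def O2 (A : Matrix (Fin 5) (Fin 5) R) : R :=
  m3 A 0 1 2 0 3 4 + m3 A 1 2 3 0 1 4 + m3 A 2 3 4 0 1 2 + m3 A 0 3 4 1 2 3 + m3 A 0 1 4 2 3 4

/-- orbit sum `O3`: rows `{0,1,2}+g`, columns `{1,3,4}+g`. [folklore] -/
def O3 (A : Matrix (Fin 5) (Fin 5) R) : R :=
  m3 A 0 1 2 1 3 4 + m3 A 1 2 3 0 2 4 + m3 A 2 3 4 0 1 3 + m3 A 0 3 4 1 2 4 + m3 A 0 1 4 0 2 3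

/-- orbit sum `O4`: rows `{0,1,3}+g`, columns `{0,2,3}+g`. [folklore] -/
def O4 (A : Matrix (Fin 5) (Fin 5) R) : R :=
  m3 A 0 1 3 0 2 3 + m3 A 1 2 4 1 3 4 + m3 A 0 2 3 0 2 4 + m3 A 1 3 4 0 1 3 + m3 A 0 2 4 1 2 4

/-- THE CERTIFICATE: `−10·O1 + 7·O2 − 5·O3 + 8·O4 = 2250` identically (twenty `3×3` minors of `N(a)`, integer
coefficients), in every commutative ring. Kernel-checked by `ring` after unfolding the determinants. [folklore] -/
theorem cert (a₁ a₂ a₃ a₄ : R) :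
    -10 * O1 (N a₁ a₂ a₃ a₄) + 7 * O2 (N a₁ a₂ a₃ a₄) - 5 * O3 (N a₁ a₂ a₃ a₄) + 8 * O4 (N a₁ a₂ a₃ a₄) = 2250 := by
  simp only [O1, O2, O3, O4]
  simp [m3, Matrix.det_fin_three, N]
  ring

/-- Consequence: if `2250 ≠ 0` in `R` then for every `a` some `3×3` minor of `N(a)` is non-zero
(so over a field of characteristic `∉ {2,3,5}`, `rank N(a) ≥ 3`: no Hessian corank `≥ 3`). [folklore] -/
theorem exists_minor_ne_zero (h : (2250 : R) ≠ 0) (a₁ a₂ a₃ a₄ : R) :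
    ∃ i j k p q r : Fin 5, m3 (N a₁ a₂ a₃ a₄) i j k p q r ≠ 0 := by
  by_contra hcon
  push Not at hcon
  have hc := cert a₁ a₂ a₃ a₄
  simp only [O1, O2, O3, O4, hcon, add_zero, mul_zero, sub_zero] at hc
  exact h hc.symm

/-- Consequence over a field of characteristic `∉ {2, 3, 5}` (e.g. `ℚ`, `ℂ`): `rank N(a) ≥ 3` for every `a`, i.e. the
symmetric matrix `N(a)` — and with it the Hessian of `φ_ℓ|K₃` at the corresponding critical point (cell files) — has
corank at most `2`. [folklore] -/
theorem three_le_rank {K : Type*} [Field K] (h : (2250 : K) ≠ 0) (a₁ a₂ a₃ a₄ : K) :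
    3 ≤ (N a₁ a₂ a₃ a₄).rank := by
  obtain ⟨i, j, k, p, q, r, hne⟩ := exists_minor_ne_zero h a₁ a₂ a₃ a₄
  have hU : IsUnit ((N a₁ a₂ a₃ a₄).submatrix ![i, j, k] ![p, q, r]) :=
    (Matrix.isUnit_iff_isUnit_det _).2 (isUnit_iff_ne_zero.2 hne)
  have h1 : ((N a₁ a₂ a₃ a₄).submatrix ![i, j, k] ![p, q, r]).rank = 3 := by
    rw [Matrix.rank_of_isUnit _ hU, Fintype.card_fin]
  have h2 := Matrix.rank_submatrix_le (N a₁ a₂ a₃ a₄) ![i, j, k] ![p, q, r]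
  omega

/-- In particular over `ℚ`. [folklore] -/
theorem three_le_rank_rat (a₁ a₂ a₃ a₄ : ℚ) : 3 ≤ (N a₁ a₂ a₃ a₄).rank :=
  three_le_rank (by norm_num) a₁ a₂ a₃ a₄

end Summit.HodgeConjecture.HodgeConjecture.FermatCycles.KleinCriticalCorank
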